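import Summits.Ventures.PercRepro.LemmaBPlusUpTo4A
import Summits.Ventures.PercRepro.LemmaBPlusUpTo4B
import Summits.Ventures.PercRepro.LemmaBPlusUpTo4C
import Summits.Ventures.PercRepro.LemmaBPlusUpTo4D

/-!
# `C005UpTo 4` and `C011UpTo 4`, fully kernel-checked

The census `∀ b : Fin 6 → Bool, ∀ m injective, 0 ≤ (graphOf (matrixOf4 b)).cubeSumC011Z m` of typer-2's
`C005UpTo_of_upper` is discharged: the triangle `b`
(typer-2's `C005UpTo_of_upper`), the triangle is one of the 64 codes `cfgOf 6 n` (`exists_cfgOf`), the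
graph is re-indexed to `g_n` (`cubeSumC011_graphFin`, `graphFin_n`), and `topCheck_n` (the kernel)
gives `0 ≤ CS` for every injective marking (`cubeSumC011_nonneg_of_topCheck`).  Hence
**`lemmaBPlusSimpleInj4 : LemmaBPlusSimpleInjUpTo 4`**, **`c005UpTo4 : C005UpTo 4`** and
**`c011UpTo4 : C011UpTo 4`**: C-005 and C-011 hold on EVERY multigraph with at most four vertices
(loops and parallel edges included), for every `p ∈ [0,1]^E` and every marking — no computation
outside the Lean kernel.
-/

namespace PercRepro

open MultiGraph Examples

/-- The kernel Boolean of every triangle code. -/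
theorem topCheck_graphFin (n : Fin 64) : (graphFin (cfgOf 6 n.val)).topCheck = true := by
  fin_cases n
  · rw [graphFin_0]; exact topCheck_0
  · rw [graphFin_1]; exact topCheck_1
  · rw [graphFin_2]; exact topCheck_2
  · rw [graphFin_3]; exact topCheck_3
  · rw [graphFin_4]; exact topCheck_4
  · rw [graphFin_5]; exact topCheck_5
  · rw [graphFin_6]; exact topCheck_6
  · rw [graphFin_7]; exact topCheck_7
  · rw [graphFin_8]; exact topCheck_8
  · rw [graphFin_9]; exact topCheck_9
  · rw [graphFin_10]; exact topCheck_10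
  · rw [graphFin_11]; exact topCheck_11
  · rw [graphFin_12]; exact topCheck_12
  · rw [graphFin_13]; exact topCheck_13
  · rw [graphFin_14]; exact topCheck_14
  · rw [graphFin_15]; exact topCheck_15
  · rw [graphFin_16]; exact topCheck_16
  · rw [graphFin_17]; exact topCheck_17
  · rw [graphFin_18]; exact topCheck_18
  · rw [graphFin_19]; exact topCheck_19
  · rw [graphFin_20]; exact topCheck_20
  · rw [graphFin_21]; exact topCheck_21
  · rw [graphFin_22]; exact topCheck_22
  · rw [graphFin_23]; exact topCheck_23
  · rw [graphFin_24]; exact topCheck_24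
  · rw [graphFin_25]; exact topCheck_25
  · rw [graphFin_26]; exact topCheck_26
  · rw [graphFin_27]; exact topCheck_27
  · rw [graphFin_28]; exact topCheck_28
  · rw [graphFin_29]; exact topCheck_29
  · rw [graphFin_30]; exact topCheck_30
  · rw [graphFin_31]; exact topCheck_31
  · rw [graphFin_32]; exact topCheck_32
  · rw [graphFin_33]; exact topCheck_33
  · rw [graphFin_34]; exact topCheck_34
  · rw [graphFin_35]; exact topCheck_35
  · rw [graphFin_36]; exact topCheck_36
  · rw [graphFin_37]; exact topCheck_37
  · rw [graphFin_38]; exact topCheck_38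
  · rw [graphFin_39]; exact topCheck_39
  · rw [graphFin_40]; exact topCheck_40
  · rw [graphFin_41]; exact topCheck_41
  · rw [graphFin_42]; exact topCheck_42
  · rw [graphFin_43]; exact topCheck_43
  · rw [graphFin_44]; exact topCheck_44
  · rw [graphFin_45]; exact topCheck_45
  · rw [graphFin_46]; exact topCheck_46
  · rw [graphFin_47]; exact topCheck_47
  · rw [graphFin_48]; exact topCheck_48
  · rw [graphFin_49]; exact topCheck_49
  · rw [graphFin_50]; exact topCheck_50
  · rw [graphFin_51]; exact topCheck_51
  · rw [graphFin_52]; exact topCheck_52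
  · rw [graphFin_53]; exact topCheck_53
  · rw [graphFin_54]; exact topCheck_54
  · rw [graphFin_55]; exact topCheck_55
  · rw [graphFin_56]; exact topCheck_56
  · rw [graphFin_57]; exact topCheck_57
  · rw [graphFin_58]; exact topCheck_58
  · rw [graphFin_59]; exact topCheck_59
  · rw [graphFin_60]; exact topCheck_60
  · rw [graphFin_61]; exact topCheck_61
  · rw [graphFin_62]; exact topCheck_62
  · rw [graphFin_63]; exact topCheck_63

/-- The kernel Boolean of every triangle. -/
theorem topCheck_all (b : Fin 6 → Bool) : (graphFin b).topCheck = true := by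
  obtain ⟨n, rfl⟩ := exists_cfgOf (k := 6) b
  exact topCheck_graphFin n

/-- **The upper-triangle census on four vertices**: `0 ≤ CS(graphOf (matrixOf4 b), m)` for every triangle
`b` and every injective marking `m`. -/
theorem census4 (b : Fin 6 → Bool) (m : Fin 4 → Fin 4) (hm : Function.Injective m) :
    0 ≤ (graphOf (matrixOf4 b)).cubeSumC011Z m := by
  rw [← cubeSumC011_nonneg_iff_Z, ← cubeSumC011_graphFin]
  exact (graphFin b).cubeSumC011_nonneg_of_topCheck (topCheck_all b) m hm

/-- **Lemma B⁺ on every simple graph with ≤ 4 vertices, every injective marking** — kernel-checked. -/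
theorem lemmaBPlusSimpleInj4 : LemmaBPlusSimpleInjUpTo 4 := LemmaBPlusSimpleInjUpTo_of_upper census4

/-- **C-005 on every multigraph with ≤ 4 vertices at every `p`** — kernel-checked end to end. -/
theorem c005UpTo4 : C005UpTo 4 := C005UpTo_of_upper census4

/-- **C-011 on every multigraph with ≤ 4 vertices at every `p`** — kernel-checked end to end. -/
theorem c011UpTo4 : C011UpTo 4 := C011UpTo_of_upper census4

end PercRepro
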